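/-
Copyright (c) 2026 the pub-hodgecm-mathlib formalisation cell (harness21).  Prover seat hodgecm-mathlib-F0P3a-p08 (g20): road «S3-ram» (LEAD F0P3a-plan (g13);
owner F0P3a-p06 (g15)), (T2) G-side organ (Cnt2′) (chair F0P3a-p07 (g14)), ROW SOCKET `T2G_reg` — the lattice PARENT LAW «q · n_reg = n_bd»; 2026-09-02.
-/
import Literature.NumberTheory.Automorphic.UnitaryLatticeTreeLevelTwoGrandchildLevelRamified   -- ★ p847775 (this seat): organ (D) `map_sub_one_le_scaleLattice_of_adj_adj_of_lev_sq`
import Literature.NumberTheory.Automorphic.UnitaryLatticeTreeTwoDeepNilpotencyTokenRamified     -- (this seat): organ (N′) `map_sub_one_pow_three_le_scaleLattice_of_twoDeep_of_{lev,fixed}`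
import Literature.NumberTheory.Automorphic.UnitaryLatticeTreeNoTransvectionTokenRamified        -- ★ p847686 (LH4-p01 (g0)): NO-TV `not_lev₂_of_not_lev_of_fixed_selfDual`
import Literature.NumberTheory.Automorphic.UnitaryLatticeTreeFixedStarLevelZeroRamified         -- ★ (F0P2-p06 (g13)): `fixedGrandchildren_eq_empty_of_levelZero`
import Literature.NumberTheory.Automorphic.UnitaryLatticeTreeFixedRowLeafRamified               -- ★ ROW-C p847560 (F0P2-p01 (g15)): `fixedGrandchildren_eq_empty_of_rankOne_depthOne`
import Literature.NumberTheory.Automorphic.UnitaryLatticeTreeFixedRowRegularRamified            -- ★ ROW-R p847563 (F0P3-p03 (g15)): `fixedGrandchildren_not_lev_and_ncard_of_regular_one`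
import Literature.NumberTheory.Automorphic.UnitaryLatticeTreeStarOfInvolution                   -- ★ (B-p14): alternation `isSelfDualLattice_iff_not_isSelfDualLattice_of_adj_of_v`
import Literature.NumberTheory.Automorphic.UnitaryThreeDoubleCosetsHK                           -- ★ `UnitaryGroup.mem_unitaryInt_iff_forall_v_apply_le_one`
import Literature.Combinatorics.SimpleGraph.TreeDescendantPartition                             -- ★ G1 p847239 (F0P2-p02 (g13)): `exists_rooted_parent`, `parentClosed_fixedPoints`
import HarnessLib

/-!
# The lattice graph of a hermitian space — THE PARENT LAW «`q · n_reg = n_bd`» for a `ϖ²`-deep unitary element (tame-ramified place): every fixed self-dual vertex of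
# depth `0` hangs under exactly one fixed self-dual vertex of depth `1` and rank `2`, which carries exactly `q` of them (Bruhat–Tits 1972 §10; Kottwitz 1986 §3)

Topic `NumberTheory/Automorphic`; namespace `Literature.NumberTheory.Automorphic.UnitaryLatticeTree`.  THEOREMS ONLY (no definition, no instance, no notation, no named fact,
no `sorry`); kernel lane `--supports stmt-HodgeConjecture-24833`.  Cell `pub/hodgecm-mathlib` (D-0151), crux H413; road «S3-ram» (Literature seeding, count-neutral); (T2)
G-side organ (Cnt2′) of the fold `LocalTransferAtOneTameRamified` (chair F0P3a-p07 (g14), skeleton v2), ROW SOCKET `T2G_reg` (this seat; chair's text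
`socket-T2G_reg_{even,odd}.F0P3ap07g14.txt`: per literal `δ`, `q · #S_reg(δ) = #S_bd(δ)`).  THIS FILE is the LATTICE ORGAN beneath it (statement-first sha16 aac9f02a, HOME
`F0/P3a/F0P3a-p08/g20/reg/`; chair ruling 02:05:27Z (1)): in the `J₀`-model `(K³, σ, J₀)` over a discretely valued field `K` (`σ` a valuation-preserving involution with
`σϖ = −ϖ`, residually trivial, residue characteristic `≠ 2`, finite residue field), for EVERY `γ ∈ U(σ, J₀)` with **`|γ − 1| ≤ |ϖ|²` entrywise** (the normalised `v`-deep
image `e δ` of the literal, ★ `vDeep_frame_of_vDeep`) one has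
  **`#{M self-dual | γM = M, ¬LEV ϖ} = |𝓀| · #{M self-dual | γM = M, LEV ϖ ∧ ¬LEV ϖ² ∧ ¬LEV₂ ϖ³}`**
(`Set.ncard`, no finiteness hypothesis: if the right set is infinite so is the left and both counts read `0`).  The CM head `typeTwo_stratumReg_{even,odd}_ram`
(`Rogawski1990/DepthZeroKappaTransferTypeTwoRamifiedStratumReg`) transports it to the coset currency of the socket by ★ A1′ (F0P3a-p05 p847358).

THE PROOF (★ organs by name; root `r₀ = 𝒪³`, rooted parent `p` of ★ G1 `exists_rooted_parent`, fixed set `F` parent-closed by ★ `parentClosed_fixedPoints`, types alternate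
along edges ★ `isSelfDualLattice_iff_not_isSelfDualLattice_of_adj_of_v`).  (A) `r₀` is fixed with `LEV(ϖ²)` (`|γ − 1| ≤ |ϖ|²`), so `r₀` is neither `bd` nor `reg`.  (B) Every fixed
self-dual `w ≠ r₀` is a GRANDCHILD of the fixed self-dual `g = p(p(w))` (the rows' shape `GC(g) = {w | ∃ c, (g ~ c, dist c = dist g + 1, γc = c) ∧ (c ~ w, dist w = dist c + 1,
γw = w)}`), and `g` is the ONLY vertex with `w ∈ GC(g)`.  (C) If `g` is `bd` then `GC(g) = ∅` (★ LevelZero, `hrk` by ★ NO-TV, `hnil` by ★ (N′)); so every fixed self-dual vertex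
with a grandchild has `LEV ϖ` — in particular the grandparent of any oriented vertex, which is the orientation datum `hup` of ★ ROW-R ∕ ROW-C.  (D) If `LEV[g](ϖ²)` then every
grandchild has `LEV ϖ` (★ organ (D)).  (E) If `g` has depth exactly `1` and rank `≤ 1` then `GC(g) = ∅` (★ ROW-C).  Hence the grandparent of a `bd` vertex is `reg`; conversely
(F) a `reg` vertex has exactly `q` grandchildren, all `bd` (★ ROW-R).  So `bd = ⊔_{g ∈ reg} GC(g)` with fibres of size `q` (§2), which is the count (§3, `Finset.card_eq_sum_card_fiberwise`).

* §1 `mem_unitaryInt_of_twoDeep` (`γ ∈ K₀`), `map_sub_one_le_scaleLattice_sq_root_of_twoDeep` (`LEV[r₀](ϖ²)`).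
* §2 `lev_of_exists_fixedGrandchild` ((C): a fixed self-dual vertex with a fixed grandchild has `LEV ϖ`).
* §3 **`ncard_selfDual_fixed_levelZero_eq_card_mul_ncard_regularOne`** (THE PARENT LAW, Submodule-set currency = the right-hand sides of ★ A1′
  `ncard_fixedBy_{bd,interior_reg}_eq_ncard_selfDual_fixed_ramified` at `H = J₀`).

HONEST LABEL: HC_CM is proved only modulo the 2 remaining named inputs (hLiu418 24832, h413 24833) until rung 0 closes; nothing printed is asserted here (elementary lattice
bookkeeping over a valuation ring and a finite double count); «S3-ram» has no books consequence.

## References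
* [BruhatTits1972] F. Bruhat, J. Tits, *Groupes réductifs sur un corps local I*, Publ. Math. IHÉS 41 (1972), §10 (lattice models; vertex stabilisers and their filtrations).
* [Tits1979] J. Tits, *Reductive groups over local fields*, PSPM 33.1 (1979), §3.5 (congruence filtration; reduction mod `𝔭`), §2.4 (ramified `U(3)`).
* [Kottwitz1986] R. E. Kottwitz, *Base change for unit elements of Hecke algebras*, Compositio Math. 60 (1986), §3 (counting fixed lattices shell by shell).
* [Serre1980Trees] J.-P. Serre, *Trees* (1980), Ch. I §2.3, Ch. II §1.1 (rooted trees; fixed points of an automorphism; neighbours of a lattice).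
* [Rogawski1990] J. D. Rogawski, *Automorphic Representations of Unitary Groups in Three Variables*, Ann. of Math. Stud. 123 (1990), §4.9 Prop. 4.9.1 (a) p. 55.
-/

set_option autoImplicit false

noncomputable section

open scoped Valued WithZero Matrix MatrixGroups

namespace Literature.NumberTheory.Automorphic.UnitaryLatticeTree

open Literature.NumberTheory.Automorphic Literature.NumberTheory.Automorphic.HermitianLattice
open Literature.Combinatorics.SimpleGraph.TreeLayers

variable {K : Type*} [Field K] [Valued K ℤᵐ⁰] {σ : K →+* K} {ϖ : K}

/-! ## §1 A `ϖ²`-deep element lies in `K₀` and has level `ϖ²` at the root -/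

/-- A `ϖ²`-deep `γ ∈ U(σ, J₀)` (`|γ − 1| ≤ |ϖ|²` entrywise, `|ϖ| ≤ 1`) is integral: `γ ∈ K₀`. [cite: Tits1979, §3.5] [cite: BruhatTits1972, §10] -/
theorem mem_unitaryInt_of_twoDeep (hvσ : ∀ a, Valued.v (σ a) = Valued.v a) (hϖ : Valued.v ϖ = WithZero.exp (-1 : ℤ))
    (γ : unitaryGroupOfForm σ ((StdForm.antidiagonal 3).over K))
    (hγ2 : ∀ i j, Valued.v ((((γ : GL (Fin 3) K) : Matrix (Fin 3) (Fin 3) K) - 1) i j) ≤ Valued.v ϖ ^ 2) :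
    γ ∈ unitaryInt σ ((StdForm.antidiagonal 3).over K) := by
  have hϖ1 : Valued.v ϖ ≤ 1 := by rw [hϖ, ← WithZero.exp_zero]; exact WithZero.exp_le_exp.2 (by norm_num)
  refine (UnitaryGroup.mem_unitaryInt_iff_forall_v_apply_le_one σ rfl hvσ γ).2 fun i j => ?_
  have h1 : Valued.v ((1 : Matrix (Fin 3) (Fin 3) K) i j) ≤ 1 := by rw [Matrix.one_apply]; split_ifs <;> simp
  have heq : ((γ : GL (Fin 3) K) : Matrix (Fin 3) (Fin 3) K) i j = (((γ : GL (Fin 3) K) : Matrix (Fin 3) (Fin 3) K) - 1) i j + (1 : Matrix (Fin 3) (Fin 3) K) i j := by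
    rw [Matrix.sub_apply, sub_add_cancel]
  rw [heq]
  exact (Valuation.map_add _ _ _).trans (max_le ((hγ2 i j).trans (pow_le_one' hϖ1 2)) h1)

/-- A `ϖ²`-deep `γ` has `LEV[r₀](ϖ²)` at the root `r₀ = 𝒪³`. [cite: Kottwitz1986, §3] [cite: Serre1980Trees, II.1.1] -/
theorem map_sub_one_le_scaleLattice_sq_root_of_twoDeep (hϖ : Valued.v ϖ = WithZero.exp (-1 : ℤ))
    (γ : unitaryGroupOfForm σ ((StdForm.antidiagonal 3).over K))
    (hγ2 : ∀ i j, Valued.v ((((γ : GL (Fin 3) K) : Matrix (Fin 3) (Fin 3) K) - 1) i j) ≤ Valued.v ϖ ^ 2) :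
    (⟨stdLattice K 3, 0, isSelfDualLattice_stdLattice_three_of_v hϖ⟩ : {M : Submodule 𝒪[K] (Fin 3 → K) // IsVertex σ ϖ ((StdForm.antidiagonal 3).over K) M}).1.map
        ((Matrix.toLin' (((γ : GL (Fin 3) K) : Matrix (Fin 3) (Fin 3) K) - 1)).restrictScalars 𝒪[K]) ≤
      scaleLattice (ϖ ^ 2) (⟨stdLattice K 3, 0, isSelfDualLattice_stdLattice_three_of_v hϖ⟩ : {M : Submodule 𝒪[K] (Fin 3 → K) // IsVertex σ ϖ ((StdForm.antidiagonal 3).over K) M}).1 := by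
  have hϖ0 : ϖ ≠ 0 := fun h0 => by rw [h0, map_zero] at hϖ; exact WithZero.coe_ne_zero hϖ.symm
  have hroot := latticeGraphIso_root_eq_of_mem_unitaryInt (σ := σ) hϖ (Subgroup.one_mem (unitaryInt σ ((StdForm.antidiagonal 3).over K)))
  have h := (map_pow_le_scaleLattice_latticeGraphIso_root_iff hϖ γ 1 (pow_ne_zero 2 hϖ0) 1).2 (fun i j => by
    rw [inv_one, one_mul, mul_one, pow_one, map_pow]; exact hγ2 i j)
  rwa [pow_one, hroot] at h

/-! ## §2 A fixed self-dual vertex with a fixed grandchild has level `ϖ` -/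

set_option maxHeartbeats 800000 in
-- budget only: statement-heavy vertex tokens.
/-- **(C) A FIXED SELF-DUAL VERTEX WITH A FIXED GRANDCHILD HAS `LEV ϖ`** (for a `ϖ²`-deep `γ`): otherwise it is a depth-`0` vertex, whose fixed-grandchildren set is empty by
★ `fixedGrandchildren_eq_empty_of_levelZero` (`hrk` by ★ NO-TV, `hnil` by ★ (N′)); at the root the level is even `ϖ²`. [cite: Kottwitz1986, §3] [cite: BruhatTits1972, §10] -/
theorem lev_of_exists_fixedGrandchild (hσ : ∀ x, σ (σ x) = x) (hvσ : ∀ a, Valued.v (σ a) = Valued.v a) (hσϖ : σ ϖ = -ϖ)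
    (hϖ : Valued.v ϖ = WithZero.exp (-1 : ℤ)) (hres : ∀ x : K, Valued.v x ≤ 1 → Valued.v (σ x - x) < 1) (h2 : Valued.v (2 : K) = 1)
    (hT : (latticeGraph σ ϖ ((StdForm.antidiagonal 3).over K)).IsTree)
    (γ : unitaryGroupOfForm σ ((StdForm.antidiagonal 3).over K))
    (hγ2 : ∀ i j, Valued.v ((((γ : GL (Fin 3) K) : Matrix (Fin 3) (Fin 3) K) - 1) i j) ≤ Valued.v ϖ ^ 2)
    {g w : {M : Submodule 𝒪[K] (Fin 3 → K) // IsVertex σ ϖ ((StdForm.antidiagonal 3).over K) M}}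
    (hg : IsSelfDualLattice σ ϖ ((StdForm.antidiagonal 3).over K) g.1) (hgfix : latticeGraphIso σ ϖ ((StdForm.antidiagonal 3).over K) γ g = g)
    (hw : ∃ c, ((latticeGraph σ ϖ ((StdForm.antidiagonal 3).over K)).Adj g c ∧
          (latticeGraph σ ϖ ((StdForm.antidiagonal 3).over K)).dist ⟨stdLattice K 3, 0, isSelfDualLattice_stdLattice_three_of_v hϖ⟩ c =
            (latticeGraph σ ϖ ((StdForm.antidiagonal 3).over K)).dist ⟨stdLattice K 3, 0, isSelfDualLattice_stdLattice_three_of_v hϖ⟩ g + 1 ∧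
          latticeGraphIso σ ϖ ((StdForm.antidiagonal 3).over K) γ c = c) ∧
        ((latticeGraph σ ϖ ((StdForm.antidiagonal 3).over K)).Adj c w ∧
          (latticeGraph σ ϖ ((StdForm.antidiagonal 3).over K)).dist ⟨stdLattice K 3, 0, isSelfDualLattice_stdLattice_three_of_v hϖ⟩ w =
            (latticeGraph σ ϖ ((StdForm.antidiagonal 3).over K)).dist ⟨stdLattice K 3, 0, isSelfDualLattice_stdLattice_three_of_v hϖ⟩ c + 1 ∧
          latticeGraphIso σ ϖ ((StdForm.antidiagonal 3).over K) γ w = w)) :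
    g.1.map ((Matrix.toLin' (((γ : GL (Fin 3) K) : Matrix (Fin 3) (Fin 3) K) - 1)).restrictScalars 𝒪[K]) ≤ scaleLattice ϖ g.1 := by
  have hϖ1 : Valued.v ϖ ≤ 1 := by rw [hϖ, ← WithZero.exp_zero]; exact WithZero.exp_le_exp.2 (by norm_num)
  have hγ0 := mem_unitaryInt_of_twoDeep hvσ hϖ γ hγ2
  by_cases hgr : g = ⟨stdLattice K 3, 0, isSelfDualLattice_stdLattice_three_of_v hϖ⟩
  · -- the root has `LEV(ϖ²) ⊆ LEV ϖ`
    rw [hgr]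
    refine (map_sub_one_le_scaleLattice_sq_root_of_twoDeep hϖ γ hγ2).trans ?_
    rw [pow_two, ← scaleLattice_scaleLattice]
    exact scaleLattice_mono ϖ (scaleLattice_le_self_of_v_le_one hϖ1 _)
  by_contra hnot
  have hempty := fixedGrandchildren_eq_empty_of_levelZero hσ hvσ hσϖ hϖ h2 hT hγ0 hg hgr hgfix
    (not_lev₂_of_not_lev_of_fixed_selfDual hσ hvσ hσϖ hϖ hres h2 hγ0 hg hgfix hnot)
    (map_sub_one_pow_three_le_scaleLattice_of_twoDeep_of_fixed hϖ γ hγ2 hgfix)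
  have hmem : w ∈ ({w | ∃ c, ((latticeGraph σ ϖ ((StdForm.antidiagonal 3).over K)).Adj g c ∧
          (latticeGraph σ ϖ ((StdForm.antidiagonal 3).over K)).dist ⟨stdLattice K 3, 0, isSelfDualLattice_stdLattice_three_of_v hϖ⟩ c =
            (latticeGraph σ ϖ ((StdForm.antidiagonal 3).over K)).dist ⟨stdLattice K 3, 0, isSelfDualLattice_stdLattice_three_of_v hϖ⟩ g + 1 ∧
          latticeGraphIso σ ϖ ((StdForm.antidiagonal 3).over K) γ c = c) ∧
        ((latticeGraph σ ϖ ((StdForm.antidiagonal 3).over K)).Adj c w ∧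
          (latticeGraph σ ϖ ((StdForm.antidiagonal 3).over K)).dist ⟨stdLattice K 3, 0, isSelfDualLattice_stdLattice_three_of_v hϖ⟩ w =
            (latticeGraph σ ϖ ((StdForm.antidiagonal 3).over K)).dist ⟨stdLattice K 3, 0, isSelfDualLattice_stdLattice_three_of_v hϖ⟩ c + 1 ∧
          latticeGraphIso σ ϖ ((StdForm.antidiagonal 3).over K) γ w = w)} : Set _) := hw
  rw [hempty] at hmem
  exact hmem

/-! ## §3 The parent law -/

set_option maxHeartbeats 3200000 in
-- budget only: one long double count over statement-heavy vertex tokens (six ★ row invocations).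
/-- **THE PARENT LAW «`q · n_reg = n_bd`» FOR A `ϖ²`-DEEP UNITARY ELEMENT (tame-ramified place).**  For `γ ∈ U(σ, J₀)` with `|γ − 1| ≤ |ϖ|²` entrywise:
`#{M | M self-dual, γM = M, ¬ (γ−1)M ⊆ ϖM} = |𝓀[K]| · #{M | M self-dual, γM = M, (γ−1)M ⊆ ϖM, ¬ (γ−1)M ⊆ ϖ²M, ¬ (γ−1)²M ⊆ ϖ³M}` — every depth-`0` fixed self-dual
vertex is a grandchild of exactly one depth-`1` rank-`2` fixed self-dual vertex (★ LevelZero, ★ (D), ★ ROW-C exclude every other grandparent), which has exactly `q` of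
them (★ ROW-R).  `Set.ncard` on both sides; no finiteness hypothesis. [cite: Kottwitz1986, §3] [cite: BruhatTits1972, §10] [cite: Rogawski1990, §4.9 Prop. 4.9.1 (a) p. 55] -/
theorem ncard_selfDual_fixed_levelZero_eq_card_mul_ncard_regularOne (hσ : ∀ x, σ (σ x) = x) (hvσ : ∀ a, Valued.v (σ a) = Valued.v a) (hσϖ : σ ϖ = -ϖ)
    (hϖ : Valued.v ϖ = WithZero.exp (-1 : ℤ)) (hres : ∀ x : K, Valued.v x ≤ 1 → Valued.v (σ x - x) < 1) (h2 : Valued.v (2 : K) = 1) [Finite 𝓀[K]]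
    (hT : (latticeGraph σ ϖ ((StdForm.antidiagonal 3).over K)).IsTree)
    (γ : unitaryGroupOfForm σ ((StdForm.antidiagonal 3).over K))
    (hγ2 : ∀ i j, Valued.v ((((γ : GL (Fin 3) K) : Matrix (Fin 3) (Fin 3) K) - 1) i j) ≤ Valued.v ϖ ^ 2) :
    {M : Submodule 𝒪[K] (Fin 3 → K) | IsSelfDualLattice σ ϖ ((StdForm.antidiagonal 3).over K) M ∧ mapGL (γ : GL (Fin 3) K) M = M ∧
        ¬ M.map ((Matrix.toLin' (((γ : GL (Fin 3) K) : Matrix (Fin 3) (Fin 3) K) - 1)).restrictScalars 𝒪[K]) ≤ scaleLattice ϖ M}.ncard =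
      Nat.card 𝓀[K] *
        {M : Submodule 𝒪[K] (Fin 3 → K) | IsSelfDualLattice σ ϖ ((StdForm.antidiagonal 3).over K) M ∧ mapGL (γ : GL (Fin 3) K) M = M ∧
          (M.map ((Matrix.toLin' (((γ : GL (Fin 3) K) : Matrix (Fin 3) (Fin 3) K) - 1)).restrictScalars 𝒪[K]) ≤ scaleLattice ϖ M ∧
            ¬ M.map ((Matrix.toLin' (((γ : GL (Fin 3) K) : Matrix (Fin 3) (Fin 3) K) - 1)).restrictScalars 𝒪[K]) ≤ scaleLattice (ϖ ^ 2) M ∧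
            ¬ M.map ((Matrix.toLin' ((((γ : GL (Fin 3) K) : Matrix (Fin 3) (Fin 3) K) - 1) ^ 2)).restrictScalars 𝒪[K]) ≤ scaleLattice (ϖ ^ 3) M)}.ncard := by
  classical
  have hϖ1 : Valued.v ϖ ≤ 1 := by rw [hϖ, ← WithZero.exp_zero]; exact WithZero.exp_le_exp.2 (by norm_num)
  have hγ0 := mem_unitaryInt_of_twoDeep hvσ hϖ γ hγ2
  -- abbreviations
  set G := latticeGraph σ ϖ ((StdForm.antidiagonal 3).over K) with hGdef
  set r : {M : Submodule 𝒪[K] (Fin 3 → K) // IsVertex σ ϖ ((StdForm.antidiagonal 3).over K) M} := ⟨stdLattice K 3, 0, isSelfDualLattice_stdLattice_three_of_v hϖ⟩ with hrdef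
  set φ := latticeGraphIso σ ϖ ((StdForm.antidiagonal 3).over K) γ with hφdef
  -- tokens as predicates on vertices
  let SD : {M : Submodule 𝒪[K] (Fin 3 → K) // IsVertex σ ϖ ((StdForm.antidiagonal 3).over K) M} → Prop := fun v => IsSelfDualLattice σ ϖ ((StdForm.antidiagonal 3).over K) v.1
  let LEV : {M : Submodule 𝒪[K] (Fin 3 → K) // IsVertex σ ϖ ((StdForm.antidiagonal 3).over K) M} → K → Prop := fun v c =>
    v.1.map ((Matrix.toLin' (((γ : GL (Fin 3) K) : Matrix (Fin 3) (Fin 3) K) - 1)).restrictScalars 𝒪[K]) ≤ scaleLattice c v.1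
  let LEV2 : {M : Submodule 𝒪[K] (Fin 3 → K) // IsVertex σ ϖ ((StdForm.antidiagonal 3).over K) M} → K → Prop := fun v c =>
    v.1.map ((Matrix.toLin' ((((γ : GL (Fin 3) K) : Matrix (Fin 3) (Fin 3) K) - 1) ^ 2)).restrictScalars 𝒪[K]) ≤ scaleLattice c v.1
  let GC : {M : Submodule 𝒪[K] (Fin 3 → K) // IsVertex σ ϖ ((StdForm.antidiagonal 3).over K) M} →
      Set {M : Submodule 𝒪[K] (Fin 3 → K) // IsVertex σ ϖ ((StdForm.antidiagonal 3).over K) M} := fun v =>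
    {w | ∃ c, (G.Adj v c ∧ G.dist r c = G.dist r v + 1 ∧ φ c = c) ∧ (G.Adj c w ∧ G.dist r w = G.dist r c + 1 ∧ φ w = w)}
  let BD : Set {M : Submodule 𝒪[K] (Fin 3 → K) // IsVertex σ ϖ ((StdForm.antidiagonal 3).over K) M} := {v | SD v ∧ φ v = v ∧ ¬ LEV v ϖ}
  let REG : Set {M : Submodule 𝒪[K] (Fin 3 → K) // IsVertex σ ϖ ((StdForm.antidiagonal 3).over K) M} :=
    {v | SD v ∧ φ v = v ∧ (LEV v ϖ ∧ ¬ LEV v (ϖ ^ 2) ∧ ¬ LEV2 v (ϖ ^ 3))}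
  -- STEP 0: Submodule sets ↔ vertex sets
  have hset : ∀ P : Submodule 𝒪[K] (Fin 3 → K) → Prop,
      {M : Submodule 𝒪[K] (Fin 3 → K) | IsSelfDualLattice σ ϖ ((StdForm.antidiagonal 3).over K) M ∧ mapGL (γ : GL (Fin 3) K) M = M ∧ P M} =
        Subtype.val '' {v : {M : Submodule 𝒪[K] (Fin 3 → K) // IsVertex σ ϖ ((StdForm.antidiagonal 3).over K) M} | SD v ∧ φ v = v ∧ P v.1} := by
    intro P
    ext M
    constructor
    · rintro ⟨hM, hfix, hP⟩
      exact ⟨⟨M, 0, hM⟩, ⟨hM, (latticeGraphIso_eq_iff_mapGL_eq γ _).2 hfix, hP⟩, rfl⟩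
    · rintro ⟨v, ⟨hv, hfix, hP⟩, rfl⟩
      exact ⟨hv, (latticeGraphIso_eq_iff_mapGL_eq γ _).1 hfix, hP⟩
  have hBD : {M : Submodule 𝒪[K] (Fin 3 → K) | IsSelfDualLattice σ ϖ ((StdForm.antidiagonal 3).over K) M ∧ mapGL (γ : GL (Fin 3) K) M = M ∧
        ¬ M.map ((Matrix.toLin' (((γ : GL (Fin 3) K) : Matrix (Fin 3) (Fin 3) K) - 1)).restrictScalars 𝒪[K]) ≤ scaleLattice ϖ M}.ncard = BD.ncard := by
    rw [hset (fun M => ¬ M.map ((Matrix.toLin' (((γ : GL (Fin 3) K) : Matrix (Fin 3) (Fin 3) K) - 1)).restrictScalars 𝒪[K]) ≤ scaleLattice ϖ M),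
      Set.ncard_image_of_injective _ Subtype.val_injective]
  have hREG : {M : Submodule 𝒪[K] (Fin 3 → K) | IsSelfDualLattice σ ϖ ((StdForm.antidiagonal 3).over K) M ∧ mapGL (γ : GL (Fin 3) K) M = M ∧
          (M.map ((Matrix.toLin' (((γ : GL (Fin 3) K) : Matrix (Fin 3) (Fin 3) K) - 1)).restrictScalars 𝒪[K]) ≤ scaleLattice ϖ M ∧
            ¬ M.map ((Matrix.toLin' (((γ : GL (Fin 3) K) : Matrix (Fin 3) (Fin 3) K) - 1)).restrictScalars 𝒪[K]) ≤ scaleLattice (ϖ ^ 2) M ∧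
            ¬ M.map ((Matrix.toLin' ((((γ : GL (Fin 3) K) : Matrix (Fin 3) (Fin 3) K) - 1) ^ 2)).restrictScalars 𝒪[K]) ≤ scaleLattice (ϖ ^ 3) M)}.ncard = REG.ncard := by
    rw [hset (fun M => M.map ((Matrix.toLin' (((γ : GL (Fin 3) K) : Matrix (Fin 3) (Fin 3) K) - 1)).restrictScalars 𝒪[K]) ≤ scaleLattice ϖ M ∧
            ¬ M.map ((Matrix.toLin' (((γ : GL (Fin 3) K) : Matrix (Fin 3) (Fin 3) K) - 1)).restrictScalars 𝒪[K]) ≤ scaleLattice (ϖ ^ 2) M ∧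
            ¬ M.map ((Matrix.toLin' ((((γ : GL (Fin 3) K) : Matrix (Fin 3) (Fin 3) K) - 1) ^ 2)).restrictScalars 𝒪[K]) ≤ scaleLattice (ϖ ^ 3) M),
      Set.ncard_image_of_injective _ Subtype.val_injective]
  rw [hBD, hREG]
  -- STEP 1: the root is fixed, self-dual, with `LEV(ϖ²)`
  have hrSD : SD r := isSelfDualLattice_stdLattice_three_of_v hϖ
  have hrfix : φ r = r := latticeGraphIso_root_eq_of_mem_unitaryInt hϖ hγ0
  have hrlev2 : LEV r (ϖ ^ 2) := map_sub_one_le_scaleLattice_sq_root_of_twoDeep hϖ γ hγ2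
  have hrlev : LEV r ϖ := by
    refine hrlev2.trans ?_
    rw [pow_two, ← scaleLattice_scaleLattice]
    exact scaleLattice_mono ϖ (scaleLattice_le_self_of_v_le_one hϖ1 _)
  have hdist0 : G.dist r r = 0 := SimpleGraph.dist_self
  -- STEP 2: rooted parent, parent-closed fixed set, alternation
  obtain ⟨P, hP1, hP2, hP3, -⟩ := exists_rooted_parent hT r
  have hpc : ∀ w, φ w = w → w ≠ r → ∀ u, G.Adj w u → G.dist r u + 1 = G.dist r w → φ u = u :=
    fun w hw hwr u hwu hdu => parentClosed_fixedPoints hT r φ hrfix w hw hwr u hwu hdu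
  have halt : ∀ {v w}, G.Adj v w → (SD v ↔ ¬ SD w) := fun {v w} h => isSelfDualLattice_iff_not_isSelfDualLattice_of_adj_of_v hvσ hϖ h
  -- STEP 3 (B): the grandparent `P (P w)` of a fixed self-dual `w ≠ r`
  have hgp : ∀ w, SD w → φ w = w → w ≠ r →
      SD (P (P w)) ∧ φ (P (P w)) = P (P w) ∧ P (P w) ≠ w ∧ w ∈ GC (P (P w)) := by
    intro w hw hwfix hwr
    obtain ⟨hwc, hdc⟩ := hP1 w hwr
    have hcSD : ¬ SD (P w) := (halt hwc).1 hw
    have hcr : P w ≠ r := fun h => hcSD (h ▸ hrSD)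
    obtain ⟨hcg, hdg⟩ := hP1 (P w) hcr
    have hcfix : φ (P w) = P w := hpc w hwfix hwr (P w) hwc hdc
    have hgfix : φ (P (P w)) = P (P w) := hpc (P w) hcfix hcr (P (P w)) hcg hdg
    have hgSD : SD (P (P w)) := Classical.not_not.1 (fun h => hcSD ((halt hcg).2 h))
    refine ⟨hgSD, hgfix, fun h => ?_, ⟨P w, ⟨hcg.symm, by omega, hcfix⟩, hwc.symm, by omega, hwfix⟩⟩
    have := congrArg (G.dist r) h
    omega
  -- uniqueness of the grandparent: `w ∈ GC v ⇒ P (P w) = v`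
  have huniq : ∀ v w, w ∈ GC v → P (P w) = v := by
    rintro v w ⟨c, ⟨hvc, hdc, -⟩, hcw, hdw, -⟩
    have hcr : c ≠ r := fun h => by rw [h, hdist0] at hdc; omega
    have hPc := (hP1 c hcr).2
    have hwPc : w ≠ P c := fun h => by rw [← h] at hPc; omega
    have hPw : P w = c := (hP2 c w hcr hcw hwPc).2
    have hPcv : P c = v := by
      by_cases hvr : v = r
      · rw [hvr] at hvc ⊢; exact hP3 c hvc
      · have hPv := (hP1 v hvr).2
        exact (hP2 v c hvr hvc (fun h => by rw [← h] at hPv; omega)).2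
    rw [hPw, hPcv]
  -- STEP 4 (C): a fixed self-dual vertex with a fixed grandchild has `LEV ϖ`; ORIENTATION of a fixed self-dual `v ≠ r`
  have hlevgp : ∀ g w, SD g → φ g = g → w ∈ GC g → LEV g ϖ := fun g w hg hgfix hw =>
    lev_of_exists_fixedGrandchild hσ hvσ hσϖ hϖ hres h2 hT γ hγ2 hg hgfix hw
  have horient : ∀ v, SD v → φ v = v → v ≠ r →
      G.Adj v (P v) ∧ G.dist r (P v) + 1 = G.dist r v ∧ G.Adj (P v) (P (P v)) ∧ P (P v) ≠ v ∧ LEV (P (P v)) ϖ := by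
    intro v hv hvfix hvr
    obtain ⟨hgSD, hgfix, hgv, hmem⟩ := hgp v hv hvfix hvr
    obtain ⟨hvc, hdc⟩ := hP1 v hvr
    have hcr : P v ≠ r := fun h => ((halt hvc).1 hv) (h ▸ hrSD)
    exact ⟨hvc, hdc, (hP1 (P v) hcr).1, hgv, hlevgp _ v hgSD hgfix hmem⟩
  -- STEP 5 (A): the grandparent of a `bd` vertex is `reg` (★ LevelZero ∕ ★ (D) ∕ ★ ROW-C exclude the other labels)
  have hA : ∀ w ∈ BD, P (P w) ∈ REG ∧ w ∈ GC (P (P w)) := by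
    rintro w ⟨hw, hwfix, hwbd⟩
    have hwr : w ≠ r := fun h => hwbd (by rw [h]; exact hrlev)
    obtain ⟨hgSD, hgfix, -, hmem⟩ := hgp w hw hwfix hwr
    have hglev : LEV (P (P w)) ϖ := hlevgp _ w hgSD hgfix hmem
    have hnot2 : ¬ LEV (P (P w)) (ϖ ^ 2) := fun hlev2 => by
      obtain ⟨c, ⟨hgc, -, -⟩, hcw, -, -⟩ := hmem
      exact hwbd (map_sub_one_le_scaleLattice_of_adj_adj_of_lev_sq hσ hvσ hσϖ hϖ hres h2 γ hgSD hlev2 hgc hcw)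
    have hgr : P (P w) ≠ r := fun h => hnot2 (by rw [h]; exact hrlev2)
    have hnotrk : ¬ LEV2 (P (P w)) (ϖ ^ 3) := fun hrk => by
      obtain ⟨hp, hpin, hg', hg'v, hup⟩ := horient _ hgSD hgfix hgr
      have hempty := fixedGrandchildren_eq_empty_of_rankOne_depthOne hσ hvσ hσϖ hϖ hres h2 hT hγ0 hgSD hgr hgfix hp hpin hg' hg'v hup hglev hnot2 hrk
        (map_sub_one_pow_three_le_scaleLattice_of_twoDeep_of_lev hϖ γ hγ2 _ hglev)
      exact (Set.eq_empty_iff_forall_notMem.1 hempty w) hmem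
    exact ⟨⟨hgSD, hgfix, hglev, hnot2, hnotrk⟩, hmem⟩
  -- STEP 6 (F): a `reg` vertex has exactly `q` fixed grandchildren, all `bd` (★ ROW-R)
  have hB : ∀ v ∈ REG, (∀ w ∈ GC v, w ∈ BD) ∧ (GC v).ncard = Nat.card 𝓀[K] := by
    rintro v ⟨hv, hvfix, hlev, hlev2, hrk⟩
    have hvr : v ≠ r := fun h => hlev2 (by rw [h]; exact hrlev2)
    obtain ⟨hp, hpin, hg, hgv, hup⟩ := horient v hv hvfix hvr
    have hR := fixedGrandchildren_not_lev_and_ncard_of_regular_one hσ hvσ hσϖ hϖ hres h2 hT hγ0 hv hvr hvfix hp hpin hg hgv hup hlev hlev2 hrk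
      (map_sub_one_pow_three_le_scaleLattice_of_twoDeep_of_lev hϖ γ hγ2 v hlev)
    refine ⟨fun w hw => ?_, hR.2⟩
    have hw' := hw
    obtain ⟨c, ⟨hvc, -, -⟩, hcw, -, hwfix⟩ := hw'
    have hwSD : SD w := Classical.not_not.1 (fun h => ((halt hvc).1 hv) ((halt hcw).2 h))
    exact ⟨hwSD, hwfix, hR.1 w hw⟩
  have hq0 : Nat.card 𝓀[K] ≠ 0 := Nat.card_pos.ne'
  -- STEP 7: the count, fibre by fibre
  by_cases hfin : REG.Finite
  · have hGCfin : ∀ v ∈ REG, (GC v).Finite := fun v hv => Set.finite_of_ncard_ne_zero (by rw [(hB v hv).2]; exact hq0)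
    have hBDsub : BD ⊆ ⋃ v ∈ REG, GC v := fun w hw => Set.mem_biUnion (hA w hw).1 (hA w hw).2
    have hBDfin : BD.Finite := (hfin.biUnion hGCfin).subset hBDsub
    have hmaps : Set.MapsTo (fun w => P (P w)) (hBDfin.toFinset : Set _) (hfin.toFinset : Set _) := by
      intro w hw
      rw [Set.Finite.coe_toFinset] at hw ⊢
      exact (hA w hw).1
    have hfib : ∀ v ∈ hfin.toFinset, (hBDfin.toFinset.filter (fun w => P (P w) = v)).card = Nat.card 𝓀[K] := by
      intro v hv
      have hv' : v ∈ REG := (Set.Finite.mem_toFinset hfin).1 hv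
      rw [← (hB v hv').2, Set.ncard_eq_toFinset_card _ (hGCfin v hv')]
      congr 1
      ext w
      simp only [Finset.mem_filter, Set.Finite.mem_toFinset]
      constructor
      · rintro ⟨hw, hPw⟩
        rw [← hPw]
        exact (hA w hw).2
      · intro hw
        exact ⟨(hB v hv').1 w hw, huniq v w hw⟩
    rw [Set.ncard_eq_toFinset_card REG hfin, Set.ncard_eq_toFinset_card BD hBDfin, Finset.card_eq_sum_card_fiberwise hmaps,
      Finset.sum_congr rfl hfib, Finset.sum_const, smul_eq_mul, mul_comm]
  · -- `reg` infinite ⇒ `bd` infinite: both counts are `0`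
    have hBDinf : BD.Infinite := by
      intro hBDfin
      apply hfin
      refine (hBDfin.image (fun w => P (P w))).subset fun v hv => ?_
      obtain ⟨w, hw⟩ := Set.nonempty_of_ncard_ne_zero (s := GC v) (by rw [(hB v hv).2]; exact hq0)
      exact ⟨w, (hB v hv).1 w hw, huniq v w hw⟩
    rw [Set.Infinite.ncard hfin, Set.Infinite.ncard hBDinf, mul_zero]

end Literature.NumberTheory.Automorphic.UnitaryLatticeTree

end
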